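import Summits.HubbardSuperconductivity.HubbardSuperconductivity.Theorems.AnisotropyChordTransferFibre3RowDRho
import Summits.HubbardSuperconductivity.HubbardSuperconductivity.Theorems.AnisotropyChordTransferFibre3RowDLoopMajE
import Summits.HubbardSuperconductivity.HubbardSuperconductivity.Theorems.AnisotropyChordTransferFibre3RowDReal

/-!
# Route `AnisotropyChord` / H0 rotor rung, row D (KT-2a) Stage-1 evaluator: the NORM BOUND `‖R̂′(k̄)‖ ≤ V²t·(|ρ_closed| + Maj)`

Layer H (bound) of the row-D program (p1 g30).  With `rhat_decomp_eval` (`…RowDRho`), the loop norm bounds of Stage-1b (`…RowDLoopNorms`,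
`…RowDLoopBdry`) and their hat-unit `RExpr` mirrors (`…RowDLoopMajE`), every low coefficient satisfies, for a ground profile located in a row-D
cell (`L ≥ 128`) and rationals `τlo ≤ T⁺/θ² ≤ τhi`:
★ `rhat_norm_le : ‖R̂′(k̄₂,k̄₃)‖ ≤ V²·t·( |x| + (majE τlo τhi k₂ k₃).eval xTrueD )`, `x = ` the evaluated REAL part of the pair
`rhoE k₂ k₃` (`R̂′` is real, `…RowDReal`, so the imaginary channel is dropped), with the majorant ★ `majE = majLoopE + majNTE`:
`majLoopE = Σ_{monoList} [6·(bnd3E + bnd3E + bnd3E) + mMult·bndME + Σ_lines pvE·(6(bpgE+bpgE) + 2√t·bspE)]`,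
`majNTE = max(|τlo − 3ν|, |τhi − 3ν|)·(|ntClosedE| + 3·Σ_{monoList8} bndME)`.
Prover seat `hubbard-h0-rotor-p1` g30 (route lead); helper for piece A = stmt-HubbardSuperconductivity-23918 of rung 19089
(`--supports`, helper class).  Nothing here proves superconductivity in the Hubbard model; lemmas for ONE row of ONE conditional reduction;
the rotor TARGET as originally worded stays FALSE (g15 verdict).  Tree imports only; no sorry.
-/

set_option linter.dupNamespace false
set_option autoImplicit false

open Literature.Analysis.ValidatedNumerics

namespace Summit.HubbardSuperconductivity.HubbardSuperconductivity.Theorems.AnisotropyChord.Transfer.Fibre3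

namespace RowD

open RowC L2.N1

variable (L : ℕ) [NeZero L]

/-! ## The majorant `RExpr` -/

/-- a plain list sum of `RExpr`s. -/
def sumE : List RExpr → RExpr
  | [] => cst 0
  | e :: l => .add e (sumE l)

omit [NeZero L] in
/-- `sumE` evaluates to the list sum. [folklore] -/
theorem eval_sumE (x : ℕ → ℝ) : ∀ l : List RExpr, (sumE l).eval x = (l.map (fun e => e.eval x)).sum
  | [] => by simp [sumE, cst, RExpr.eval]
  | e :: l => by rw [sumE, RExpr.eval, eval_sumE x l, List.map_cons, List.sum_cons]

/-- one boundary line `/(V³t)`: `6(bpgE x y + bpgE y x) + 2√t·bspE y x`. -/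
def lineBndE (x y : Bool) : RExpr :=
  .add (.mul (cst 6) (.add (bpgE x y) (bpgE y x))) (.mul (.mul (cst 2) (.sqrt vT)) (bspE y x))

/-- the N-part majorant of a monomial `/(V³t)`. -/
def majNE (k3 k1 k2 : Bool) : RExpr :=
  .mul (cst 6) (.add (.add (bnd3E k3 k1 k2) (bnd3E k2 k3 k1)) (bnd3E k1 k3 k2))

/-- the M-part majorant of a monomial at `(k₂,k₃)`. -/
def majME (k3 k1 k2 : Bool) (k₂ k₃ : ℤ × ℤ) : RExpr := .mul (cst (((mMult k₂ k₃ : ℕ) : ℤ) : ℚ)) (bndME k3 k1 k2)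

/-- the boundary-part majorant of a monomial. -/
def majBE (k3 k1 k2 : Bool) : RExpr :=
  .add (.add (.mul (pvE k1) (lineBndE k3 k2)) (.mul (pvE k2) (lineBndE k3 k1))) (.mul (pvE k3) (lineBndE k2 k1))

/-- ★ the loop majorant of the class `(k₂,k₃)`: `Σ_{monoList} (majNE + majME + majBE)`. -/
def majLoopE (k₂ k₃ : ℤ × ℤ) : RExpr :=
  sumE (monoList.map (fun m => .add (.add (majNE m.2.2 m.1 m.2.1) (majME m.2.2 m.1 m.2.1 k₂ k₃)) (majBE m.2.2 m.1 m.2.1)))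

/-- `|τ − 3ν| ≤ tdevE := max(|τlo − 3ν|, |τhi − 3ν|)`. -/
def tdevE (τlo τhi : ℚ) : RExpr :=
  .max (.abs (.sub (cst τlo) (.mul (cst 3) vNu))) (.abs (.sub (cst τhi) (.mul (cst 3) vNu)))

/-- the plain-loop total of `Π̂`: `Σ_{monoList8} bndME`. -/
def ntBndE : RExpr := sumE (monoList8.map (fun m => bndME m.2.2 m.1 m.2.1))

/-- ★ the `NT` majorant: `tdev·(|ntClosedE| + 3·ntBndE)`. -/
def majNTE (τlo τhi : ℚ) (k₂ k₃ : ℤ × ℤ) : RExpr :=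
  .mul (tdevE τlo τhi) (.add (.abs (ntClosedE k₂ k₃)) (.mul (cst 3) ntBndE))

/-- ★ THE MAJORANT of the class `(k₂,k₃)`. -/
def majE (τlo τhi : ℚ) (k₂ k₃ : ℤ × ℤ) : RExpr := .add (majLoopE k₂ k₃) (majNTE τlo τhi k₂ k₃)

/-! ## The bound -/

section bound
variable (Δ lam2 : ℝ) (f : Tor L → ℝ)

/-- the norm of an evaluated pair: `‖x + iθy‖ = √(x² + θ²y²)`. [folklore] -/
theorem norm_peval (θ : ℝ) (v : ℕ → ℝ) (p : RExpr × RExpr) :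
    ‖peval θ v p‖ = Real.sqrt ((p.1.eval v) ^ 2 + θ ^ 2 * (p.2.eval v) ^ 2) := by
  unfold peval
  rw [show ((p.1.eval v : ℝ) : ℂ) + Complex.I * (θ : ℂ) * ((p.2.eval v : ℝ) : ℂ)
      = ((p.1.eval v : ℝ) : ℂ) + ((θ * p.2.eval v : ℝ) : ℂ) * Complex.I by push_cast; ring, Complex.norm_add_mul_I]
  congr 1; ring

/-- ★ one monomial: `‖monoLoopU(k̄)‖ ≤ V²t·(majNE + majME + majBE).eval`. [folklore] -/
theorem monoLoop_le (hL : 128 ≤ L) (hΔ0 : 0 ≤ Δ) (hΔ1 : Δ < 1) (hf : IsGroundTwoMagnon L Δ lam2 f) (e0 : Tor L)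
    (k3 k1 k2 : Bool) (k₂ k₃ : ℤ × ℤ) :
    ‖monoLoopU L Δ lam2 f e0 k3 k1 k2 (B1.toTor L k₂) (B1.toTor L k₃)‖
      ≤ ((L : ℝ) ^ 2) ^ 2 * (2 * Real.pi / L) ^ 2 *
        (RExpr.add (.add (majNE k3 k1 k2) (majME k3 k1 k2 k₂ k₃)) (majBE k3 k1 k2)).eval (xTrueD L Δ lam2 f) := by
  have hLpos : (0 : ℝ) < L := by exact_mod_cast (show 0 < L by omega)
  have hθ : 0 < (2 * Real.pi / L : ℝ) := by positivity
  have hV : (0 : ℝ) < (L : ℝ) ^ 2 := by positivity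
  -- the three semantic bounds
  have hN := norm_nvLoopU_le L Δ lam2 f hL hΔ0 hΔ1 hf k3 k1 k2 e0 (B1.toTor L k₂) (B1.toTor L k₃)
  have hM := norm_mLoopU_le L Δ lam2 f hL hΔ0 hΔ1 hf k3 k1 k2 e0 k₂ k₃
  have hB := norm_bLoopU_le L Δ lam2 f hL hΔ0 hΔ1 hf k3 k1 k2 (B1.toTor L k₂) (B1.toTor L k₃)
  -- the eval identities
  have e3 := fun (a b c : Bool) => eval_bnd3E L Δ lam2 f hL hΔ0 hΔ1 hf a b c
  have eM := eval_bndME L Δ lam2 f hL hΔ0 hΔ1 hf k3 k1 k2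
  have epg := fun (a b : Bool) => eval_bpgE L Δ lam2 f hL hΔ0 hΔ1 hf a b
  have esp := fun (a b : Bool) => eval_bspE L Δ lam2 f hL hΔ0 hΔ1 hf a b
  have epv := fun (k : Bool) => eval_pvE L Δ lam2 f k
  have hsqrt : Real.sqrt (xTrueD L Δ lam2 f 0) = 2 * Real.pi / L := by rw [xTrueD_zero, Real.sqrt_sq hθ.le]
  have hline : ∀ x y : Bool, ((L : ℝ) ^ 2) ^ 2 * (2 * Real.pi / L) ^ 2 * (lineBndE x y).eval (xTrueD L Δ lam2 f) = lineBnd L Δ lam2 f x y / (L : ℝ) ^ 2 := by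
    intro x y
    simp only [lineBndE, RExpr.eval, cst, vT, epg, esp, hsqrt]
    unfold lineBnd
    push_cast
    field_simp
  have hNE : ((L : ℝ) ^ 2) ^ 2 * (2 * Real.pi / L) ^ 2 * (majNE k3 k1 k2).eval (xTrueD L Δ lam2 f) = 6 * (bnd3Sum L Δ lam2 f k3 k1 k2 / (L : ℝ) ^ 2) := by
    simp only [majNE, RExpr.eval, cst, e3]
    unfold bnd3Sum
    push_cast
    field_simp
  have hME : ((L : ℝ) ^ 2) ^ 2 * (2 * Real.pi / L) ^ 2 * (majME k3 k1 k2 k₂ k₃).eval (xTrueD L Δ lam2 f)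
      = (2 * Real.pi / L) ^ 2 * (mMult k₂ k₃ : ℝ) * (bndMAt L Δ lam2 f k3 k1 k2 / (L : ℝ) ^ 2) := by
    simp only [majME, RExpr.eval, cst, eM]
    push_cast
    field_simp
  have hBE : ((L : ℝ) ^ 2) ^ 2 * (2 * Real.pi / L) ^ 2 * (majBE k3 k1 k2).eval (xTrueD L Δ lam2 f)
      = (pvR L Δ lam2 f k1 * lineBnd L Δ lam2 f k3 k2 + pvR L Δ lam2 f k2 * lineBnd L Δ lam2 f k3 k1
          + pvR L Δ lam2 f k3 * lineBnd L Δ lam2 f k2 k1) / (L : ℝ) ^ 2 := by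
    have h1 := hline k3 k2; have h2 := hline k3 k1; have h3 := hline k2 k1
    simp only [majBE, RExpr.eval, epv]
    linear_combination (pvR L Δ lam2 f k1) * h1 + (pvR L Δ lam2 f k2) * h2 + (pvR L Δ lam2 f k3) * h3
  unfold monoLoopU
  calc ‖nvLoopU L Δ lam2 f k3 k1 k2 e0 (B1.toTor L k₂) (B1.toTor L k₃) + mLoopU L Δ lam2 f k3 k1 k2 e0 (B1.toTor L k₂) (B1.toTor L k₃)
        - bLoopU L Δ lam2 f k3 k1 k2 (B1.toTor L k₂) (B1.toTor L k₃)‖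
      ≤ ‖nvLoopU L Δ lam2 f k3 k1 k2 e0 (B1.toTor L k₂) (B1.toTor L k₃)‖ + ‖mLoopU L Δ lam2 f k3 k1 k2 e0 (B1.toTor L k₂) (B1.toTor L k₃)‖
        + ‖bLoopU L Δ lam2 f k3 k1 k2 (B1.toTor L k₂) (B1.toTor L k₃)‖ := by
        refine (norm_sub_le _ _).trans ?_; gcongr; exact norm_add_le _ _
    _ ≤ _ := by
        rw [RExpr.eval, RExpr.eval, mul_add, mul_add, hNE, hME, hBE]
        linarith

/-- ★ the total loop part: `‖loopTot(k̄)‖ ≤ V²t·(majLoopE k).eval`. [folklore] -/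
theorem loopTot_le (hL : 128 ≤ L) (hΔ0 : 0 ≤ Δ) (hΔ1 : Δ < 1) (hf : IsGroundTwoMagnon L Δ lam2 f) (e0 : Tor L) (k₂ k₃ : ℤ × ℤ) :
    ‖loopTot L Δ lam2 f e0 (B1.toTor L k₂) (B1.toTor L k₃)‖
      ≤ ((L : ℝ) ^ 2) ^ 2 * (2 * Real.pi / L) ^ 2 * (majLoopE k₂ k₃).eval (xTrueD L Δ lam2 f) := by
  have T := fun (k3 k1 k2 : Bool) => monoLoop_le L Δ lam2 f hL hΔ0 hΔ1 hf e0 k3 k1 k2 k₂ k₃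
  unfold loopTot majLoopE
  rw [eval_sumE]
  simp only [monoList, List.map, List.sum_cons, List.sum_nil, add_zero, mul_add]
  have e1 := T true false false; have e2 := T false false true; have e3 := T true false true
  have e4 := T false true false; have e5 := T true true false; have e6 := T false true true; have e7 := T true true true
  exact norm_add_le_of_le e1 (norm_add_le_of_le e2 (norm_add_le_of_le e3 (norm_add_le_of_le e4
    (norm_add_le_of_le e5 (norm_add_le_of_le e6 e7)))))

/-- ★ the `NT` loop: `‖ntLoopU(k)‖ ≤ 3·Σ_8 bndMAt/V = 3·V²·ntBndE.eval`. [folklore] -/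
theorem ntLoop_le (hL : 128 ≤ L) (hΔ0 : 0 ≤ Δ) (hΔ1 : Δ < 1) (hf : IsGroundTwoMagnon L Δ lam2 f) (e0 : Tor L) (k₂ k₃ : Tor L) :
    ‖ntLoopU L Δ lam2 f e0 k₂ k₃‖ ≤ 3 * (((L : ℝ) ^ 2) ^ 2 * ntBndE.eval (xTrueD L Δ lam2 f)) := by
  have hLpos : (0 : ℝ) < L := by exact_mod_cast (show 0 < L by omega)
  have P := fun (k3 k1 k2 : Bool) (q₂ q₃ : Tor L) =>
    norm_loopPartU_plain_le L Δ lam2 f hL hΔ0 hΔ1 hf k3 k1 k2 e0 e0 e0 q₂ q₃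
  have hpi : ∀ q₂ q₃ : Tor L, ‖piLoopU L Δ lam2 f e0 q₂ q₃‖ ≤ ((L : ℝ) ^ 2) ^ 2 * ntBndE.eval (xTrueD L Δ lam2 f) := by
    intro q₂ q₃
    unfold piLoopU ntBndE
    rw [eval_sumE]
    simp only [monoList8, monoList, List.map, List.sum_cons, List.sum_nil, add_zero, mul_add,
      eval_bndME L Δ lam2 f hL hΔ0 hΔ1 hf]
    have hc : ∀ k3 k1 k2 : Bool, ((L : ℝ) ^ 2) ^ 2 * (bndMAt L Δ lam2 f k3 k1 k2 / ((L : ℝ) ^ 2) ^ 3)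
        = bndMAt L Δ lam2 f k3 k1 k2 / (L : ℝ) ^ 2 := by
      intro k3 k1 k2; field_simp
    simp only [hc]
    exact norm_add_le_of_le (P _ _ _ q₂ q₃) (norm_add_le_of_le (P _ _ _ q₂ q₃) (norm_add_le_of_le (P _ _ _ q₂ q₃)
      (norm_add_le_of_le (P _ _ _ q₂ q₃) (norm_add_le_of_le (P _ _ _ q₂ q₃) (norm_add_le_of_le (P _ _ _ q₂ q₃)
      (norm_add_le_of_le (P _ _ _ q₂ q₃) (P _ _ _ q₂ q₃)))))))
  unfold ntLoopU
  have h1 := hpi k₂ k₃; have h2 := hpi (k₂ - K1 L) k₃; have h3 := hpi k₂ (k₃ - K1 L)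
  have := norm_add_le_of_le (norm_add_le_of_le h1 h2) h3
  linarith

/-- ★★ THE NORM BOUND of a low coefficient (ground profile located in a row-D cell, `L ≥ 128`; `τlo·θ² ≤ T⁺ ≤ τhi·θ²`; `rhoOk k`). -/
theorem rhat_norm_le (hL : 128 ≤ L) (hΔ0 : 0 ≤ Δ) (hΔ1 : Δ < 1) (hf : IsGroundTwoMagnon L Δ lam2 f)
    (τlo τhi : ℚ) (hτlo : (τlo : ℝ) * (2 * Real.pi / L) ^ 2 ≤ Tplus L Δ f) (hτhi : Tplus L Δ f ≤ (τhi : ℝ) * (2 * Real.pi / L) ^ 2)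
    {k₂ k₃ : ℤ × ℤ} (hok : rhoOk k₂ k₃ = true) :
    ‖cfgDFT L (resid L Δ f) (B1.toTor L k₂) (B1.toTor L k₃)‖
      ≤ ((L : ℝ) ^ 2) ^ 2 * (2 * Real.pi / L) ^ 2 *
        (|(rhoE k₂ k₃).1.eval (xTrueD L Δ lam2 f)| + (majE τlo τhi k₂ k₃).eval (xTrueD L Δ lam2 f)) := by
  have hLpos : (0 : ℝ) < L := by exact_mod_cast (show 0 < L by omega)
  have hθ : 0 < (2 * Real.pi / L : ℝ) := by positivity
  have ht : 0 < (2 * Real.pi / L : ℝ) ^ 2 := by positivity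
  have hV : (0 : ℝ) < (L : ℝ) ^ 2 := by positivity
  have hlam : 0 < lam2 := lam2_pos L (by omega) hΔ1 hf.1
  have hreal := rhat_norm_eq_abs_re L hf (B1.toTor L k₂) (B1.toTor L k₃)
  rw [hreal, rhat_decomp_eval L Δ lam2 f (by omega) hΔ0 hΔ1 hf hlam 0 hok]
  have hnV : ‖((L : ℂ) ^ 2) ^ 2‖ = ((L : ℝ) ^ 2) ^ 2 := by rw [norm_pow, norm_pow]; simp
  -- piece A: the closed pair, real part
  have hA : (((L : ℂ) ^ 2) ^ 2 * ((((2 * Real.pi / L) ^ 2 : ℝ) : ℂ) * peval (2 * Real.pi / L) (xTrueD L Δ lam2 f) (rhoE k₂ k₃))).re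
      = ((L : ℝ) ^ 2) ^ 2 * (2 * Real.pi / L) ^ 2 * (rhoE k₂ k₃).1.eval (xTrueD L Δ lam2 f) := by
    unfold peval
    simp only [Complex.mul_re, Complex.add_re, Complex.ofReal_re, Complex.ofReal_im, Complex.mul_im, Complex.I_re, Complex.I_im,
      Complex.add_im]
    have : (((L : ℂ) ^ 2) ^ 2).re = ((L : ℝ) ^ 2) ^ 2 ∧ (((L : ℂ) ^ 2) ^ 2).im = 0 := by
      constructor
      · norm_cast
      · norm_cast
    rw [this.1, this.2]
    ring
  -- piece B: the loops
  have hB := loopTot_le L Δ lam2 f hL hΔ0 hΔ1 hf 0 k₂ k₃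
  -- piece C: the NT term
  have hν2 : xTrueD L Δ lam2 f 2 = lam2 / (2 * Real.pi / L) ^ 2 := xTrueD_two L Δ lam2 f
  have hτ : |Tplus L Δ f - 3 * lam2| ≤ (2 * Real.pi / L) ^ 2 * (tdevE τlo τhi).eval (xTrueD L Δ lam2 f) := by
    simp only [tdevE, RExpr.eval, cst, vNu, hν2]
    push_cast
    have h3 : Tplus L Δ f - 3 * lam2
        = (2 * Real.pi / L) ^ 2 * (Tplus L Δ f / (2 * Real.pi / L) ^ 2 - 3 * (lam2 / (2 * Real.pi / L) ^ 2)) := by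
      field_simp
    rw [h3, abs_mul, abs_of_pos ht]
    refine mul_le_mul_of_nonneg_left ?_ ht.le
    apply abs_le_max_abs_abs
    · have : (τlo : ℝ) ≤ Tplus L Δ f / (2 * Real.pi / L) ^ 2 := by rw [le_div_iff₀ ht]; exact hτlo
      linarith
    · have : Tplus L Δ f / (2 * Real.pi / L) ^ 2 ≤ (τhi : ℝ) := by rw [div_le_iff₀ ht]; exact hτhi
      linarith
  have hC : ‖(((Tplus L Δ f - 3 * lam2 : ℝ) : ℂ))
        * (((L : ℂ) ^ 2) ^ 2 * ((((ntClosedE k₂ k₃).eval (xTrueD L Δ lam2 f) : ℝ)) : ℂ) + ntLoopU L Δ lam2 f 0 (B1.toTor L k₂) (B1.toTor L k₃))‖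
      ≤ ((L : ℝ) ^ 2) ^ 2 * (2 * Real.pi / L) ^ 2 * (majNTE τlo τhi k₂ k₃).eval (xTrueD L Δ lam2 f) := by
    rw [norm_mul, Complex.norm_real, Real.norm_eq_abs]
    have hin : ‖((L : ℂ) ^ 2) ^ 2 * ((((ntClosedE k₂ k₃).eval (xTrueD L Δ lam2 f) : ℝ)) : ℂ) + ntLoopU L Δ lam2 f 0 (B1.toTor L k₂) (B1.toTor L k₃)‖
        ≤ ((L : ℝ) ^ 2) ^ 2 * (|(ntClosedE k₂ k₃).eval (xTrueD L Δ lam2 f)| + 3 * ntBndE.eval (xTrueD L Δ lam2 f)) := by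
      have h1 : ‖((L : ℂ) ^ 2) ^ 2 * ((((ntClosedE k₂ k₃).eval (xTrueD L Δ lam2 f) : ℝ)) : ℂ)‖ = ((L : ℝ) ^ 2) ^ 2 * |(ntClosedE k₂ k₃).eval (xTrueD L Δ lam2 f)| := by
        rw [norm_mul, Complex.norm_real, Real.norm_eq_abs, hnV]
      have h2 := ntLoop_le L Δ lam2 f hL hΔ0 hΔ1 hf 0 (B1.toTor L k₂) (B1.toTor L k₃)
      refine (norm_add_le _ _).trans ?_
      rw [h1]
      linarith
    have hdev0 : 0 ≤ (2 * Real.pi / L) ^ 2 * (tdevE τlo τhi).eval (xTrueD L Δ lam2 f) := le_trans (abs_nonneg _) hτ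
    calc |Tplus L Δ f - 3 * lam2| * ‖((L : ℂ) ^ 2) ^ 2 * ((((ntClosedE k₂ k₃).eval (xTrueD L Δ lam2 f) : ℝ)) : ℂ) + ntLoopU L Δ lam2 f 0 (B1.toTor L k₂) (B1.toTor L k₃)‖
        ≤ ((2 * Real.pi / L) ^ 2 * (tdevE τlo τhi).eval (xTrueD L Δ lam2 f)) * (((L : ℝ) ^ 2) ^ 2 * (|(ntClosedE k₂ k₃).eval (xTrueD L Δ lam2 f)| + 3 * ntBndE.eval (xTrueD L Δ lam2 f))) :=
          mul_le_mul hτ hin (norm_nonneg _) hdev0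
      _ = ((L : ℝ) ^ 2) ^ 2 * (2 * Real.pi / L) ^ 2 * (majNTE τlo τhi k₂ k₃).eval (xTrueD L Δ lam2 f) := by
          simp only [majNTE, RExpr.eval, cst]; push_cast; ring
  -- assemble: `|Re(A + B − C)| ≤ |Re A| + ‖B‖ + ‖C‖`
  simp only [majE, RExpr.eval]
  rw [Complex.sub_re, Complex.add_re, hA]
  have hBre := (Complex.abs_re_le_norm (loopTot L Δ lam2 f 0 (B1.toTor L k₂) (B1.toTor L k₃))).trans hB
  have hCre := (Complex.abs_re_le_norm ((((Tplus L Δ f - 3 * lam2 : ℝ) : ℂ))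
        * (((L : ℂ) ^ 2) ^ 2 * ((((ntClosedE k₂ k₃).eval (xTrueD L Δ lam2 f) : ℝ)) : ℂ)
          + ntLoopU L Δ lam2 f 0 (B1.toTor L k₂) (B1.toTor L k₃)))).trans hC
  have hVt : 0 ≤ ((L : ℝ) ^ 2) ^ 2 * (2 * Real.pi / L) ^ 2 := by positivity
  have hx : |((L : ℝ) ^ 2) ^ 2 * (2 * Real.pi / L) ^ 2 * (rhoE k₂ k₃).1.eval (xTrueD L Δ lam2 f)|
      = ((L : ℝ) ^ 2) ^ 2 * (2 * Real.pi / L) ^ 2 * |(rhoE k₂ k₃).1.eval (xTrueD L Δ lam2 f)| := by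
    rw [abs_mul, abs_of_nonneg hVt]
  have habs := abs_sub (((L : ℝ) ^ 2) ^ 2 * (2 * Real.pi / L) ^ 2 * (rhoE k₂ k₃).1.eval (xTrueD L Δ lam2 f)
      + (loopTot L Δ lam2 f 0 (B1.toTor L k₂) (B1.toTor L k₃)).re)
    ((((Tplus L Δ f - 3 * lam2 : ℝ) : ℂ)) * (((L : ℂ) ^ 2) ^ 2 * ((((ntClosedE k₂ k₃).eval (xTrueD L Δ lam2 f) : ℝ)) : ℂ)
        + ntLoopU L Δ lam2 f 0 (B1.toTor L k₂) (B1.toTor L k₃))).re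
  have hadd := abs_add_le (((L : ℝ) ^ 2) ^ 2 * (2 * Real.pi / L) ^ 2 * (rhoE k₂ k₃).1.eval (xTrueD L Δ lam2 f))
    (loopTot L Δ lam2 f 0 (B1.toTor L k₂) (B1.toTor L k₃)).re
  rw [hx] at hadd
  linarith [habs, hadd, hBre, hCre]

end bound

end RowD

end Summit.HubbardSuperconductivity.HubbardSuperconductivity.Theorems.AnisotropyChord.Transfer.Fibre3
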